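import Summits.ResolutionOfSingularities.ResolutionOfSingularities.Theorems.PurelyInseparableDim4ResConeLevelTwoTripleFree
import Summits.ResolutionOfSingularities.ResolutionOfSingularities.Theorems.PurelyInseparableDim4ResConeLevelTwoLegalityChild
import Summits.ResolutionOfSingularities.ResolutionOfSingularities.Theorems.PurelyInseparableDim4ResConeLightTripleMinor
import Summits.ResolutionOfSingularities.ResolutionOfSingularities.Theorems.PurelyInseparableDim4ResConePowerChain
import Summits.ResolutionOfSingularities.ResolutionOfSingularities.Theorems.PurelyInseparableDim4ResConeStretchKill
import HarnessLib
import HarnessLib.Audit.Tags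

/-!
# Purely inseparable four-folds — the LIGHT TRIPLE TAIL, part 2 (K25b): ONE STEP of the triple-merged ledger
# along the chain — transport, exact contact form, legality, the two minors (K2(p) lane, slice B, A∞ assembly)

[OURS · counted 0 · cell `res-dim4-pi` · K2(p) lane holder res-dim4-p-12 g3's brick (K25) «A∞(T) ASSEMBLY =
light triple tail» by signature (bus 2026-08-29 00:46Z), seat res-dim4-p-2 g4 (lineage res-dim4-p-2).]  Nothing
here proves K2(p)/K2(5), `NoIsolatedTrap p p` or resolution of singularities in dimension ≥ 4 / characteristic
`p`; this is the chain-level bookkeeping of the light regime (idea-4's class A∞, `d = 3`).  AI kernel work, weaker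
than expert review.

Setting: an isolated above-floor `Step0 p` chain `c` with witnesses `(j, b)`, `x^{r₀} ∣ F₀`, constant shade
`d = 3 < p` from `k₀` on, frame data at the stages `k` and `k + 1` (`resForm = a·L^d`, `ℓ_k(j_k) + ℓ_k·b_k = 0`,
`ℓ_{k+1} = λ_k ℓ_k` off `j_k` — the conjuncts of `ResCone.chain_powerCone_package`), the light bound
`p ≤ r_X + r_Y + 3` at stage `k + 1`, and at stage `k` a TRIPLE-MERGED LEDGER
`u·G_k = S·(x_{P₁} x_{P₂} x_{P₃}) + T·h^d` (`u(0) ≠ 0`, `h ∈ 𝔪₀`, `lin h = κ·L_k` EXACT) on three letters of which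
`P₂, P₃` are boundary letters KEPT by the step (`b_k(P₂) = b_k(P₃) = 0`, `j_k ∉ {P₂, P₃}`) and the fourth letter
`e` is free and carries `L_k`.
**`triple_step`** delivers at stage `k + 1`, on the new triple `{j_k, P₂, P₃}`:
* the transported ledger `T₀u·G_{k+1} = S′·(x_{j_k} x_{P₂} x_{P₃}) + (U₀·T₀T)·(T₁h)^d` (res-dim4-p-9 g3's K22 (ii)
  `levelTwo_transport_triple` at the chart `P₁`, K22b `levelTwo_transport_triple_free` at the free chart — the
  direction equation makes these the only two cases and shows `b_k(P₁) ≠ 0`, `ℓ_k(P₁) ≠ 0` in the second), the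
  weights (`1 ≤ r′_{j_k}`, `r′_{P₂} = r_{P₂}`, `r′_{P₃} = r_{P₃}`) and the new free fourth letter `e′` with
  `ℓ_k(e′) ≠ 0`;
* the EXACT contact form `lin (T₁h) = κ′·L_{k+1}` (K22 (iii) reset of `h` + K25a
  `exists_homogeneousComponent_one_eq_of_sub_mem_span_X` + `lin_exact_of_triple_ledger` at the child);
* LEGALITY `σ(w) = 0` (res-dim4-p-3 g3's K23 `levelTwo_seed_triple` at the child + `legality_sigma_direction_eq_zero`)
  and the two MINORS `σ_{P₂} ℓ_{e′} ≠ σ_{e′} ℓ_{P₂}`, `σ_{P₃} ℓ_{e′} ≠ σ_{e′} ℓ_{P₃}` (K23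
  `not_isIsolated_child_of_minor_eq_zero` against the isolation of `c (k+1)`), `σ = lin S`;
* the linear coefficients of the new cofactor off the new letter: `coeff_{x_i} S′ = U(0)·σ_i` (`i ≠ j_k`).
bears_on: LADDER-RESOLUTION:D157-DOOR2 (res-dim4-pi · K2(p) · slice B · K25b).  Supports
stmt-ResolutionOfSingularities-16155 (helper).
-/

set_option linter.dupNamespace false -- mandated namespace of this single-conjunct summit

noncomputable section

namespace Summit.ResolutionOfSingularities.ResolutionOfSingularities.Theorems.PIDim4

namespace ResCone

open MvPolynomial Finset
open Literature.AlgebraicGeometry.Resolution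
open Literature.AlgebraicGeometry.Resolution.CentreBlowup
open Literature.AlgebraicGeometry.Resolution.Hauser2010
open Literature.AlgebraicGeometry.Resolution.HauserPerlega2019
open PointBlowup (polarMap additiveSubspace direction)

variable {K : Type} [Field K]

section Chain

variable (p : ℕ) [hp : Fact p.Prime] [CharP K p] [DecidableEq K]

/-- **ONE STEP OF THE TRIPLE-MERGED LEDGER ALONG THE CHAIN** (K25b; see the module docstring for the reading of
every conjunct of the conclusion). [OURS] [cite: CossartJannsenSaito2020, Thm. 3.10(4), Thm. 3.14, Thm. 9.3] -/
theorem triple_step {c : ℕ → State K} {j : ℕ → Fin 4} {b : ℕ → Fin 4 → K}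
    (hc : ∀ k, IsIsolated p (c k).F ∧ Step0 p (c k) (c (k + 1))) (hw : FreeTail.IsWitnessedChain p c j b)
    (hr0 : ∀ e ∈ (c 0).F.support, (c 0).r ≤ e) (hfloor : ∀ k, ordZero (c k).F ≠ p) {k₀ d : ℕ} (hd3 : d = 3)
    (hdp : d < p) (hshade : ∀ k, k₀ ≤ k → (c k).shade = (d : ℕ∞)) {k : ℕ} (hk : k₀ ≤ k)
    {ℓ ℓ' : Fin 4 → K} {a₀ a₀' lam : K}
    (hform : resForm (c k) = C a₀ * (∑ i, C (ℓ i) * X i) ^ d) (hdir : ℓ (j k) + dotProduct ℓ (b k) = 0)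
    (hform' : resForm (c (k + 1)) = C a₀' * (∑ i, C (ℓ' i) * X i) ^ d) (hlam : lam ≠ 0)
    (hprop : ∀ i, i ≠ j k → ℓ' i = lam * ℓ i)
    (hw3' : ∀ X Y : Fin 4, X ≠ Y → 1 ≤ (c (k + 1)).r X → 1 ≤ (c (k + 1)).r Y →
      p ≤ (c (k + 1)).r X + (c (k + 1)).r Y + 3)
    {P₁ P₂ P₃ e : Fin 4} (h12 : P₁ ≠ P₂) (h13 : P₁ ≠ P₃) (h23 : P₂ ≠ P₃) (he1 : e ≠ P₁) (he2 : e ≠ P₂)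
    (he3 : e ≠ P₃) (hr2 : 1 ≤ (c k).r P₂) (hr3 : 1 ≤ (c k).r P₃) (hre : (c k).r e = 0) (hℓe : ℓ e ≠ 0)
    (hb2 : b k P₂ = 0) (hb3 : b k P₃ = 0) (hj2 : j k ≠ P₂) (hj3 : j k ≠ P₃)
    {u S T h : MvPolynomial (Fin 4) K} {κ : K} (hu : MvPolynomial.eval (0 : Fin 4 → K) u ≠ 0)
    (hh : h ∈ originIdeal K) (hlin : homogeneousComponent 1 h = C κ * (∑ i, C (ℓ i) * X i))
    (hG : u * ((c k).F.divMonomial (c k).r) = S * (X P₁ * X P₂ * X P₃) + T * h ^ d) :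
    ∃ (e' : Fin 4) (S' U : MvPolynomial (Fin 4) K) (κ' : K),
      e' ≠ j k ∧ e' ≠ P₂ ∧ e' ≠ P₃ ∧ (c (k + 1)).r e' = 0 ∧ ℓ e' ≠ 0 ∧
      1 ≤ (c (k + 1)).r (j k) ∧ (c (k + 1)).r P₂ = (c k).r P₂ ∧ (c (k + 1)).r P₃ = (c k).r P₃ ∧
      MvPolynomial.eval (0 : Fin 4 → K) (chartTransform 0 Finset.univ (j k) (shear (j k) (b k) u)) ≠ 0 ∧
      chartTransform 1 Finset.univ (j k) (shear (j k) (b k) h) ∈ originIdeal K ∧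
      homogeneousComponent 1 (chartTransform 1 Finset.univ (j k) (shear (j k) (b k) h)) =
        C κ' * (∑ i, C (ℓ' i) * X i) ∧
      chartTransform 0 Finset.univ (j k) (shear (j k) (b k) u) * ((c (k + 1)).F.divMonomial (c (k + 1)).r) =
        S' * (X (j k) * X P₂ * X P₃) +
          ((∏ i ∈ Finset.univ.filter (fun i => b k i ≠ 0), (X i + C (b k i)) ^ ((c k).r i)) *
            chartTransform 0 Finset.univ (j k) (shear (j k) (b k) T)) *
            chartTransform 1 Finset.univ (j k) (shear (j k) (b k) h) ^ d ∧
      coeff (Finsupp.single (j k) 1) S +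
          ∑ i, coeff (Finsupp.single i 1) S * b k i * (if i = j k then 0 else 1) = 0 ∧
      coeff (Finsupp.single P₂ 1) S * ℓ e' - coeff (Finsupp.single e' 1) S * ℓ P₂ ≠ 0 ∧
      coeff (Finsupp.single P₃ 1) S * ℓ e' - coeff (Finsupp.single e' 1) S * ℓ P₃ ≠ 0 ∧
      MvPolynomial.eval (0 : Fin 4 → K) U ≠ 0 ∧
      (∀ i, i ≠ j k → coeff (Finsupp.single i 1) S' =
        MvPolynomial.eval (0 : Fin 4 → K) U * coeff (Finsupp.single i 1) S) := by
  classical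
  have hd3' : 3 ≤ d := by omega
  have hd2 : 2 ≤ d := by omega
  have hd1 : 1 ≤ d := by omega
  -- band data at `k` and `k + 1`
  obtain ⟨o, ho, hpo, -, hod⟩ := chain_shade_nat p hc hfloor hshade hk
  obtain ⟨o', ho', -, -, hod'⟩ := chain_shade_nat p hc hfloor hshade (show k₀ ≤ k + 1 by omega)
  have ho2 : o + 2 ≤ 2 * p := by
    obtain ⟨o₁, ho₁, -, ho₁2⟩ := BandShade.exists_ordZero_eq p hc k
    rw [ho] at ho₁
    have h1 : o = o₁ := by exact_mod_cast ho₁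
    have hp2 : 2 ≤ p := hp.out.two_le
    omega
  have hr := IsolatedBand.isolated_chain_forall_le hc hr0 k
  have hr' := IsolatedBand.isolated_chain_forall_le hc hr0 (k + 1)
  have hck := (hw k).2.2.2.2
  have hbj := (hw k).2.1
  -- the four letters at stage `k`
  have hcov : ∀ i : Fin 4, i = P₁ ∨ i = P₂ ∨ i = P₃ ∨ i = e := fun i => by
    have h1 := Finset.mem_univ i
    rw [univ_eq_of_four h12 h13 he1.symm h23 he2.symm he3.symm] at h1
    simpa [Finset.mem_insert, Finset.mem_singleton] using h1
  -- the residual, its cone and the seed at stage `k`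
  have hcone : homogeneousComponent d ((c k).F.divMonomial (c k).r) = C a₀ * (∑ i, C (ℓ i) * X i) ^ d := by
    have h1 := hform
    rw [resForm_eq_homogeneousComponent_divMonomial ho hr, hod] at h1
    exact h1
  have ha₀ : a₀ ≠ 0 := ne_zero_of_resForm_eq_C_mul ho hr hform
  have hordG : ∀ m ∈ ((c k).F.divMonomial (c k).r).support, d ≤ m.degree := by
    rw [← hod]; exact forall_le_degree_divMonomial ho
  obtain ⟨hS2, hTκ⟩ := levelTwo_seed_triple_order hd3' hG hh hordG hcone hlin he3 hℓe
  have hκ : κ ≠ 0 := by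
    rintro rfl
    rw [zero_pow (by omega), mul_zero] at hTκ
    exact mul_ne_zero hu ha₀ hTκ.symm
  have hSm : S ∈ originIdeal K := by
    have h1 := (levelTwo_seed_triple hd3' hG hh hordG hcone hlin he3 hℓe).1
    rw [MvPolynomial.eval_zero] at h1
    exact (NarrowApolarity.mem_originIdeal_iff S).mpr h1
  -- isolation in residual form and the weights at stage `k`
  have hisoG : IsIsolated p (monomial (c k).r (1 : K) * ((c k).F.divMonomial (c k).r)) := by
    rw [monomial_mul_divMonomial hr]; exact (hc k).1
  have h23w := pair_add_three_le_of_triple_ledger h23 hh hu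
    (show u * ((c k).F.divMonomial (c k).r) = S * (X P₂ * X P₃ * X P₁) + T * h ^ d by rw [hG]; ring) hd2 _ hisoG
  have hr2q : (c k).r P₂ + 2 ≤ p := by omega
  have hr3q : (c k).r P₃ + 2 ≤ p := by omega
  -- exponent bookkeeping `d = o − |r|`
  have hG' : u * ((c k).F.divMonomial (c k).r) = S * (X P₁ * X P₂ * X P₃) + T * h ^ (o - (c k).r.degree) := by
    rw [hod]; exact hG
  have hS' : ∀ m ∈ S.support, o - (c k).r.degree - 2 ≤ m.degree := by rw [hod]; exact hS2
  have hd2' : 2 ≤ o - (c k).r.degree := by rw [hod]; exact hd2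
  -- the new boundary
  have hrstep := step_r_univ p (j k) hbj (c k) ho hr
  rw [← hck] at hrstep
  have hr'j : (c (k + 1)).r (j k) = o - p := by rw [hrstep, Finsupp.update_apply, if_pos rfl]
  have hr'2 : (c (k + 1)).r P₂ = (c k).r P₂ := by
    rw [hrstep, Finsupp.update_apply, if_neg hj2.symm, Finsupp.filter_apply, if_pos hb2]
  have hr'3 : (c (k + 1)).r P₃ = (c k).r P₃ := by
    rw [hrstep, Finsupp.update_apply, if_neg hj3.symm, Finsupp.filter_apply, if_pos hb3]
  have hr'j1 : 1 ≤ (c (k + 1)).r (j k) := by rw [hr'j]; omega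
  -- the lost units
  set U0 : MvPolynomial (Fin 4) K :=
    ∏ i ∈ Finset.univ.filter (fun i => b k i ≠ 0), (X i + C (b k i)) ^ ((c k).r i) with hU0def
  have hU0 : MvPolynomial.eval (0 : Fin 4 → K) U0 ≠ 0 := by
    rw [hU0def, map_prod]
    refine Finset.prod_ne_zero_iff.mpr fun i hi => ?_
    rw [map_pow, map_add, MvPolynomial.eval_X, MvPolynomial.eval_C, Pi.zero_apply, zero_add]
    exact pow_ne_zero _ (Finset.mem_filter.mp hi).2
  -- THE TRANSPORT (K22 (ii) at the chart `P₁`, K22b at the free chart `e`)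
  obtain ⟨S', U, e', hU, hpres, hrel, he'j, he'2, he'3, hre', hℓe'⟩ :
      ∃ (S' U : MvPolynomial (Fin 4) K) (e' : Fin 4), MvPolynomial.eval (0 : Fin 4 → K) U ≠ 0 ∧
        chartTransform 0 Finset.univ (j k) (shear (j k) (b k) u) * ((c (k + 1)).F.divMonomial (c (k + 1)).r) =
          S' * (X (j k) * X P₂ * X P₃) + (U0 * chartTransform 0 Finset.univ (j k) (shear (j k) (b k) T)) *
            chartTransform 1 Finset.univ (j k) (shear (j k) (b k) h) ^ d ∧
        S' - U * chartTransform 1 Finset.univ (j k) (shear (j k) (b k) S) ∈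
          Ideal.span {(X (j k) * X P₂ * X P₃ : MvPolynomial (Fin 4) K)} ∧
        e' ≠ j k ∧ e' ≠ P₂ ∧ e' ≠ P₃ ∧ (c (k + 1)).r e' = 0 ∧ ℓ e' ≠ 0 := by
    by_cases hjk : j k = P₁
    · -- self chart at `P₁`: the fourth letter stays `e`
      have hG1 : u * ((c k).F.divMonomial (c k).r) =
          S * (X (j k) * X P₂ * X P₃) + T * h ^ (o - (c k).r.degree) := by rw [hjk]; exact hG'
      obtain ⟨S', h1, h2⟩ := levelTwo_transport_triple (q := p) (j k) hbj ho hr hpo ho2 hj2 hj3 h23 hb2 hb3 hr2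
        hr2q hr3 hr3q hd2' hh hG1 hS'
      rw [← hck, hod] at h1
      rw [hod, show d - 2 = 1 by omega] at h2
      have hej : e ≠ j k := by rw [hjk]; exact he1
      refine ⟨S', U0, e, hU0, h1, h2, hej, he2, he3, ?_, hℓe⟩
      rw [hrstep, Finsupp.update_apply, if_neg hej, Finsupp.filter_apply, hre, ite_self]
    · -- free chart: `j k = e`, and the direction equation gives `b_k(P₁) ≠ 0`, `ℓ(P₁) ≠ 0`
      have hje : j k = e := by
        rcases hcov (j k) with h1 | h1 | h1 | h1
        · exact absurd h1 hjk
        · exact absurd h1 hj2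
        · exact absurd h1 hj3
        · exact h1
      have hbe : b k e = 0 := by rw [← hje]; exact hbj
      have hdot : dotProduct ℓ (b k) = ℓ P₁ * b k P₁ := by
        unfold dotProduct
        rw [sum_univ_of_four h12 h13 he1.symm h23 he2.symm he3.symm, hb2, hb3, hbe]
        ring
      rw [hje, hdot] at hdir
      have hb1 : b k P₁ ≠ 0 := fun h0 => hℓe (by rw [h0, mul_zero, add_zero] at hdir; exact hdir)
      have hℓ1 : ℓ P₁ ≠ 0 := fun h0 => hℓe (by rw [h0, zero_mul, add_zero] at hdir; exact hdir)
      obtain ⟨S', h1, h2⟩ := levelTwo_transport_triple_free (q := p) (j k) hbj ho hr hpo ho2 hjk hj2 hj3 h23 hb2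
        hb3 hr2 hr2q hr3 hr3q hd2' hh hG' hS'
      rw [← hck, hod] at h1
      rw [hod, show d - 2 = 1 by omega] at h2
      refine ⟨S', U0 * (X P₁ + C (b k P₁)), P₁, ?_, h1, h2, Ne.symm hjk, h12, h13, ?_, hℓ1⟩
      · rw [map_mul, map_add, MvPolynomial.eval_X, MvPolynomial.eval_C, Pi.zero_apply, zero_add]
        exact mul_ne_zero hU0 hb1
      · rw [hrstep, Finsupp.update_apply, if_neg (Ne.symm hjk), Finsupp.filter_apply, if_neg hb1]
  -- AT THE CHILD: residual data
  have hcone' : homogeneousComponent d ((c (k + 1)).F.divMonomial (c (k + 1)).r) =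
      C a₀' * (∑ i, C (ℓ' i) * X i) ^ d := by
    have h1 := hform'
    rw [resForm_eq_homogeneousComponent_divMonomial ho' hr', hod'] at h1
    exact h1
  have ha₀' : a₀' ≠ 0 := ne_zero_of_resForm_eq_C_mul ho' hr' hform'
  have hordG' : ∀ m ∈ ((c (k + 1)).F.divMonomial (c (k + 1)).r).support, d ≤ m.degree := by
    rw [← hod']; exact forall_le_degree_divMonomial ho'
  have hu' : MvPolynomial.eval (0 : Fin 4 → K) (chartTransform 0 Finset.univ (j k) (shear (j k) (b k) u)) ≠ 0 := by
    rw [eval_chartTransform_zero_shear]; exact hu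
  -- the RESET of `h` (K22 (iii)), its constant `κ·ℓ(w) = 0`, and the `Σ_univ` form
  have hcoefh : ∀ i, coeff (Finsupp.single i 1) h = κ * ℓ i := fun i => by
    have h1 := congrArg (coeff (Finsupp.single i 1)) hlin
    rw [coeff_homogeneousComponent, Finsupp.degree_single, if_pos rfl, coeff_C_mul, coeff_single_linearForm] at h1
    exact h1
  have hreseth := chartTransform_one_shear_sub_linear_mem_span_X (j k) (b k) h hh
  have hsumh : (∑ i ∈ Finset.univ.erase (j k), C (coeff (Finsupp.single i 1) h) * (X i : MvPolynomial (Fin 4) K)) =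
      ∑ i ∈ Finset.univ.erase (j k), C (κ * ℓ i) * X i :=
    Finset.sum_congr rfl fun i _ => by rw [hcoefh]
  have hconsth : coeff (Finsupp.single (j k) 1) h +
      ∑ i, coeff (Finsupp.single i 1) h * b k i * (if i = j k then 0 else 1) = κ * (ℓ (j k) + dotProduct ℓ (b k)) := by
    simp_rw [hcoefh]
    rw [dotProduct, mul_add, Finset.mul_sum]
    congr 1
    refine Finset.sum_congr rfl fun i _ => ?_
    split_ifs with hi
    · rw [hi, hbj]; ring
    · ring
  rw [hsumh, hconsth] at hreseth
  have hhw : κ * (ℓ (j k) + dotProduct ℓ (b k)) = 0 := by rw [hdir, mul_zero]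
  have hh2 : chartTransform 1 Finset.univ (j k) (shear (j k) (b k) h) - C κ * (∑ i, C (ℓ i) * X i) ∈
      Ideal.span {(X (j k) : MvPolynomial (Fin 4) K)} := by
    have h1 : C κ * (∑ i, C (ℓ i) * (X i : MvPolynomial (Fin 4) K)) =
        (C (κ * (ℓ (j k) + dotProduct ℓ (b k))) + ∑ i ∈ Finset.univ.erase (j k), C (κ * ℓ i) * X i) +
          C (κ * ℓ (j k)) * X (j k) := by
      rw [hhw, C_0, zero_add, Finset.mul_sum, ← Finset.add_sum_erase _ _ (Finset.mem_univ (j k))]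
      simp only [← mul_assoc, ← C_mul]
      ring
    rw [h1, ← sub_sub]
    exact Submodule.sub_mem _ hreseth (Ideal.mul_mem_left _ _ (Ideal.subset_span rfl))
  have hh'm : chartTransform 1 Finset.univ (j k) (shear (j k) (b k) h) ∈ originIdeal K := by
    obtain ⟨R, hR⟩ := Ideal.mem_span_singleton'.mp hh2
    have h1 : chartTransform 1 Finset.univ (j k) (shear (j k) (b k) h) = C κ * (∑ i, C (ℓ i) * X i) + R * X (j k) := by
      rw [hR]; ring
    rw [h1]
    refine (originIdeal K).add_mem (Ideal.mul_mem_left _ _ ?_)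
      (Ideal.mul_mem_left _ _ (IsolatedScope.X_mem_originIdeal _))
    exact (NarrowApolarity.mem_originIdeal_iff _).mpr (by simp [map_sum, constantCoeff_X])
  -- the EXACT linear part of the new contact polynomial
  obtain ⟨γ, hγ⟩ := exists_homogeneousComponent_one_eq_of_sub_mem_span_X hh2 hlam hprop
  have hdK : (d : K) ≠ 0 := natCast_ne_zero_of_lt p (by omega) hdp
  have hℓ'e' : ℓ' e' ≠ 0 := by rw [hprop e' he'j]; exact mul_ne_zero hlam hℓe'
  obtain ⟨hγ0, -, -⟩ := lin_exact_of_triple_ledger (c := P₃) hj2 he'j he'2 hd1 hdK hpres hh'm hordG' hcone' hγ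
    ha₀' hu' hℓ'e'
  rw [hγ0, C_0, zero_mul, add_zero] at hγ
  -- the seed at the child and LEGALITY
  have hS'0 := (levelTwo_seed_triple hd3' hpres hh'm hordG' hcone' hγ he'3 hℓ'e').1
  have hresetS := chartTransform_one_shear_sub_linear_mem_span_X (j k) (b k) S hSm
  have hleg := legality_sigma_direction_eq_zero hrel hresetS hU hS'0
  -- the two MINORS, against the isolation of `c (k + 1)`
  have hisoG' : IsIsolated p (monomial (c (k + 1)).r (1 : K) * ((c (k + 1)).F.divMonomial (c (k + 1)).r)) := by
    rw [monomial_mul_divMonomial hr']; exact (hc (k + 1)).1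
  have hq2 : p ≤ (c (k + 1)).r (j k) + (c (k + 1)).r P₃ + 3 := hw3' _ _ hj3 hr'j1 (by rw [hr'3]; exact hr3)
  have hq3 : p ≤ (c (k + 1)).r (j k) + (c (k + 1)).r P₂ + 3 := hw3' _ _ hj2 hr'j1 (by rw [hr'2]; exact hr2)
  have hm2 : coeff (Finsupp.single P₂ 1) S * ℓ e' - coeff (Finsupp.single e' 1) S * ℓ P₂ ≠ 0 := fun hmin =>
    not_isIsolated_child_of_minor_eq_zero hj2 hj3 (Ne.symm he'j) h23 (Ne.symm he'2) (Ne.symm he'3) hu' hh'm hd3'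
      hpres hrel hresetS hleg hreseth hhw hκ hℓe' hmin _ hq2 hisoG'
  have hpres3 : chartTransform 0 Finset.univ (j k) (shear (j k) (b k) u) *
      ((c (k + 1)).F.divMonomial (c (k + 1)).r) =
      S' * (X (j k) * X P₃ * X P₂) + (U0 * chartTransform 0 Finset.univ (j k) (shear (j k) (b k) T)) *
        chartTransform 1 Finset.univ (j k) (shear (j k) (b k) h) ^ d := by
    rw [hpres]; ring
  have hrel3 : S' - U * chartTransform 1 Finset.univ (j k) (shear (j k) (b k) S) ∈
      Ideal.span {(X (j k) * X P₃ * X P₂ : MvPolynomial (Fin 4) K)} := by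
    rwa [mul_right_comm] at hrel
  have hm3 : coeff (Finsupp.single P₃ 1) S * ℓ e' - coeff (Finsupp.single e' 1) S * ℓ P₃ ≠ 0 := fun hmin =>
    not_isIsolated_child_of_minor_eq_zero hj3 hj2 (Ne.symm he'j) h23.symm (Ne.symm he'3) (Ne.symm he'2) hu' hh'm
      hd3' hpres3 hrel3 hresetS hleg hreseth hhw hκ hℓe' hmin _ hq3 hisoG'
  -- the linear coefficients of `S'` off the new letter
  have hS'mod : S' - U * (∑ i, C (coeff (Finsupp.single i 1) S) * X i) ∈
      Ideal.span {(X (j k) : MvPolynomial (Fin 4) K)} := by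
    have h1 : Ideal.span {(X (j k) * X P₂ * X P₃ : MvPolynomial (Fin 4) K)} ≤
        Ideal.span {(X (j k) : MvPolynomial (Fin 4) K)} :=
      Ideal.span_singleton_le_span_singleton.mpr ⟨X P₂ * X P₃, by ring⟩
    have h2 := Ideal.mul_mem_left _ U hresetS
    rw [hleg, C_0, zero_add] at h2
    have h3 : U * (∑ i, C (coeff (Finsupp.single i 1) S) * (X i : MvPolynomial (Fin 4) K)) =
        U * (∑ i ∈ Finset.univ.erase (j k), C (coeff (Finsupp.single i 1) S) * X i) +
          U * C (coeff (Finsupp.single (j k) 1) S) * X (j k) := by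
      rw [← Finset.add_sum_erase _ _ (Finset.mem_univ (j k))]; ring
    have h4 : S' - U * (∑ i, C (coeff (Finsupp.single i 1) S) * X i) =
        (S' - U * chartTransform 1 Finset.univ (j k) (shear (j k) (b k) S)) +
          U * (chartTransform 1 Finset.univ (j k) (shear (j k) (b k) S) -
            ∑ i ∈ Finset.univ.erase (j k), C (coeff (Finsupp.single i 1) S) * X i) -
          U * C (coeff (Finsupp.single (j k) 1) S) * X (j k) := by
      rw [h3]; ring
    rw [h4]
    exact Submodule.sub_mem _ (Submodule.add_mem _ (h1 hrel) h2) (Ideal.mul_mem_left _ _ (Ideal.subset_span rfl))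
  have hcoefS' : ∀ i, i ≠ j k → coeff (Finsupp.single i 1) S' =
      MvPolynomial.eval (0 : Fin 4 → K) U * coeff (Finsupp.single i 1) S :=
    fun i hi => coeff_single_of_sub_mul_linearFormSum_mem_span_X hi hS'mod
  exact ⟨e', S', U, κ * lam⁻¹, he'j, he'2, he'3, hre', hℓe', hr'j1, hr'2, hr'3, hu', hh'm, hγ, hpres, hleg, hm2, hm3,
    hU, hcoefS'⟩

end Chain

end ResCone

end Summit.ResolutionOfSingularities.ResolutionOfSingularities.Theorems.PIDim4

end
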